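import Mathlib
import HarnessLib
import Literature.Analysis.FluidPDE.SuitableWeak
import Literature.Analysis.FluidPDE.LerayHopf
import Literature.Analysis.FluidPDE.ClassicalSolution
import Literature.Analysis.FluidPDE.NSCriticalClosureBesovKatoClass
import Summits.NavierStokesRegularity.NavierStokesRegularity.Theorems.QuarterJoltJoltFlatCell
import Summits.NavierStokesRegularity.NavierStokesRegularity.Theorems.QuarterJoltTypeIFlatCell
import Summits.NavierStokesRegularity.NavierStokesRegularity.Theorems.QuarterJoltTypeIJoltLaw

/-!
# Route QuarterJolt — crux `NoTerminalJolt` (stmt-NavierStokesRegularity-26463), LEAD line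
# `regular_split`: THE LOCAL TYPE-I JOLT LAW and THE LOCAL FORM OF THE CRUX

Seat ns-ntj-p1 g5 (LEAD of the crux; `--supports 26463 --as helper`).

The crux `NoTerminalJolt` is a statement about the GLOBAL jolt functional
`D(t) = (√(T−t))⁻¹ ∫_{ℝ³} ‖u(t) − u(T)‖²`. Its LOCAL version at a point `x₀` and radius `R > 0` is
`D_R(t; x₀) = (√(T−t))⁻¹ ∫_{B_R(x₀)} ‖u(t) − u(T)‖²` (always `D_R ≤ D`). OBSERVATION (read off the landed
proof `JoltFlatCell.main_of_isTypeIBlowup`, p628564): the two triangle inequalities through the terminal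
value `u(T)` that make the scaled cell energy at `x₀` vanish only ever integrate `‖u(t) − u(T)‖²` over
the balls `B_r(x₀)`, `r` small — so the jolt functional may be replaced by its local version on ANY
fixed ball about `x₀`. Consequences (all sorry-free, standard axioms):

* `JoltFlatCell.main_of_isTypeIBlowup_local` — Leray–Hopf on `[0,T]` + Type-I rate at `T` + NO LOCAL
  JOLT at `x₀` (`D_R(·; x₀) → 0` for some `R > 0`) ⇒ the scaled cell energy at `x₀` vanishes.
* `NoTerminalJolt.not_singularVertex_of_isTypeIBlowup_of_tendsto_localJoltFunctional` — in the frame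
  (classical on `[0,T)`, Leray–Hopf on `[0,T]`) with the Type-I rate at `T`, a point without local jolt
  is NOT a singular vertex (`NoFlatCellVertex.main_of_isTypeIBlowup`, ε-regularity).
* **`NoTerminalJolt.typeI_localJoltLaw` — THE LOCAL TYPE-I JOLT LAW**: in the frame with the Type-I
  rate at `T`, at a SINGULAR VERTEX `(T, x₀)` the local jolt functional `D_R(·; x₀)` does NOT tend to
  `0`, for EVERY `R > 0`: the self-similar-rate `L²` approach to the terminal value is witnessed on
  every ball about every Type-I singular point (`limsup` form:
  `typeI_exists_frequently_le_localJoltFunctional`). Strictly refines the global law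
  `typeI_terminalJoltLaw` (p629148), which only saw `D ≥ D_R`.
* `NoTerminalJolt.typeI_exists_localJoltPoint` — a Type-I FIRST blow-up in the frame (rapidly
  decaying datum) has a point all of whose balls jolt
  (`exists_singularPoint_of_classical_of_not_hasSmoothExtensionPast`).
* `NoTerminalJolt.hasSmoothExtensionPast_of_isTypeIBlowup_of_localNoJolt` — continuation criterion:
  Type-I rate at `T` + «every point has a jolt-free ball» ⇒ smooth extension past `T`.
* `NoTerminalJolt.tendsto_localJoltFunctional_of_tendsto_joltFunctional` — `D → 0 ⇒ D_R(·; x₀) → 0`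
  (so everything here is implied by the corresponding global statement).
* THE LOCAL FORM OF THE CRUX SUFFICES FOR THE ROUTE — companion file
  `QuarterJoltLocalNoTerminalJolt.lean`: `EnstrophyQuarterLaw ∧ LocalNTJ ⇒ Clay (A)` and
  `NoTypeII (0056) ∧ LocalNTJ ⇒ NoBlowup (0054)`, where `LocalNTJ := «in the frame, ∀ x₀ ∃ R > 0,
  D_R(·; x₀) → 0»` is the pointwise-local weakening of the crux (spelled out inline there).

HONEST FRAMING: statements about HYPOTHETICAL Type-I blow-ups and conditional implications between
OPEN statements. Nothing here proves `NoTerminalJolt` (stmt-26463), its local form,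
`EnstrophyQuarterLaw` (stmt-1574), `NoTypeIBlowup` (stmt-1217), `NoTypeII` (stmt-0056), `NoBlowup`
(stmt-0054) or Navier–Stokes regularity — all OPEN; no summit statement is proved here. Lint note:
the import of `QuarterJoltTypeIJoltLaw` (→ `LerayQuarterDissipationRecordTimeTypeI` →
`Theses.LerayQuarterDissipation`) carries the known `theses-cone` advisory, as for the route's other
landed files. [folklore]
-/

noncomputable section

-- the summit and its single sub-problem share the name (CONVENTIONS §1), as in every Theorems file
set_option linter.dupNamespace false

namespace Summit.NavierStokesRegularity.NavierStokesRegularity.Theorems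

open MeasureTheory Set Function Filter Topology Metric
open scoped NNReal ENNReal
open Literature.Analysis.FluidPDE

namespace JoltFlatCell

/-- For an `L²(μ)` field the lower Lebesgue integral of `‖f‖²` is the honest Bochner integral,
`∫⁻ ‖f‖ₑ² ∂μ = ofReal (∫ ‖f‖² ∂μ)` — the measure-generic form of `lintegral_enorm_sq_eq_ofReal`
(used with `μ = volume.restrict (ball x₀ R)`). -/
theorem lintegral_enorm_sq_eq_ofReal_integral {μ : Measure (EuclideanSpace ℝ (Fin 3))}
    {f : EuclideanSpace ℝ (Fin 3) → EuclideanSpace ℝ (Fin 3)} (hf : MemLp f 2 μ) :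
    ∫⁻ x, ‖f x‖ₑ ^ 2 ∂μ = ENNReal.ofReal (∫ x, ‖f x‖ ^ 2 ∂μ) := by
  have hint : Integrable (fun x => ‖f x‖ ^ 2) μ := (memLp_two_iff_integrable_sq_norm hf.1).1 hf
  rw [integral_eq_lintegral_of_nonneg_ae (Eventually.of_forall fun x => sq_nonneg ‖f x‖)
    hint.aestronglyMeasurable, ENNReal.ofReal_toReal hint.lintegral_lt_top.ne]
  refine lintegral_congr fun x => ?_
  rw [← ofReal_norm, ENNReal.ofReal_pow (norm_nonneg _)]

/-- **JoltFlatCell under the plain Type-I rate, LOCAL form.** If `u` is Leray–Hopf on `[0,T]`, obeys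
the Type-I rate `‖u(t,x)‖ ≤ C/√(T−t)` for `t < T` near `T`, and has NO LOCAL TERMINAL JOLT AT `x₀`:
for some `R > 0`, `(√(T−t))⁻¹ ∫_{B_R(x₀)} ‖u(t) − u(T)‖² → 0` as `t ↑ T`, then the scaled cell energy at
`x₀` vanishes: `∀ ε > 0 ∃ r₀ > 0 ∀ r ∈ (0,r₀) ∀ t ∈ (T−r², T]: ∫_{B_r(x₀)}|u(t)|² ≤ ε r`. Same proof as
`main_of_isTypeIBlowup` (two triangle inequalities through `u(T)` on the balls `B_r(x₀) ⊆ B_R(x₀)`,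
the Type-I bound at the one earlier time `T − θr²`), with `r₀ ≤ R`. [folklore] -/
theorem main_of_isTypeIBlowup_local {ν T : ℝ} (hT : 0 < T)
    {u : ℝ → EuclideanSpace ℝ (Fin 3) → EuclideanSpace ℝ (Fin 3)}
    (hLH : IsLerayHopfOn T ν 0 (u 0) u) (hTI : IsTypeIBlowup u T)
    (x₀ : EuclideanSpace ℝ (Fin 3)) {R : ℝ} (hR : 0 < R)
    (hJ : Tendsto (fun t : ℝ => (Real.sqrt (T - t))⁻¹ * ∫ x in ball x₀ R, ‖u t x - u T x‖ ^ 2)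
      (𝓝[<] T) (𝓝 0))
    {ε : ℝ} (hε : 0 < ε) :
    ∃ r₀ : ℝ, 0 < r₀ ∧ ∀ r : ℝ, 0 < r → r < r₀ → ∀ t ∈ Ioc (T - r ^ 2) T,
      ∫⁻ x in ball x₀ r, ‖u t x‖ₑ ^ 2 ≤ ENNReal.ofReal (ε * r) := by
  -- Step 1: the velocity Type-I rate is the HYPOTHESIS `hTI`
  obtain ⟨C, hC⟩ := hTI
  -- the volume of the unit ball as a real number
  obtain ⟨V, hV0, hV⟩ : ∃ V : ℝ, 0 ≤ V ∧ volume (ball (0 : EuclideanSpace ℝ (Fin 3)) 1) = ENNReal.ofReal V :=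
    ⟨_, ENNReal.toReal_nonneg, (ENNReal.ofReal_toReal measure_ball_lt_top.ne).symm⟩
  -- the depth parameter `θ` and the jolt threshold `δ`
  obtain ⟨θ, hθ1, hθε⟩ : ∃ θ : ℝ, 1 ≤ θ ∧ 4 * C ^ 2 * V / θ ≤ ε / 4 := by
    refine ⟨max 1 (16 * C ^ 2 * V / ε), le_max_left _ _, ?_⟩
    have hθ0 : 0 < max 1 (16 * C ^ 2 * V / ε) := lt_of_lt_of_le one_pos (le_max_left _ _)
    have h' : 16 * C ^ 2 * V ≤ max 1 (16 * C ^ 2 * V / ε) * ε := (div_le_iff₀ hε).1 (le_max_right _ _)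
    rw [div_le_iff₀ hθ0]
    linarith
  have hθ0 : 0 < θ := by linarith
  have hsθ : 1 ≤ Real.sqrt θ := Real.one_le_sqrt.2 hθ1
  have hsθ0 : 0 < Real.sqrt θ := by linarith
  -- the Type-I cell constant `W = C²|B₁|/θ`
  obtain ⟨W, hW0, hWε, hWdef⟩ : ∃ W : ℝ, 0 ≤ W ∧ 4 * W ≤ ε / 4 ∧ W = C ^ 2 * V / θ :=
    ⟨C ^ 2 * V / θ, by positivity, by
      have h : 4 * (C ^ 2 * V / θ) = 4 * C ^ 2 * V / θ := by ring
      rw [h]; exact hθε, rfl⟩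
  obtain ⟨δ, hδ0, hδ1, hδ2⟩ : ∃ δ : ℝ, 0 < δ ∧ 4 * δ * Real.sqrt θ = ε / 4 ∧ 2 * δ ≤ ε / 8 := by
    refine ⟨ε / (16 * Real.sqrt θ), by positivity, ?_, ?_⟩
    · field_simp
      ring
    · have h : 2 * (ε / (16 * Real.sqrt θ)) = ε / (8 * Real.sqrt θ) := by
        field_simp
        ring
      rw [h]
      exact div_le_div_of_nonneg_left hε.le (by norm_num) (by linarith)
  -- Step 2: the window `(T₁, T)` on which the Type-I bound and `D_R < δ` hold
  have h2 : ∀ᶠ t in 𝓝[<] T, (Real.sqrt (T - t))⁻¹ * ∫ x in ball x₀ R, ‖u t x - u T x‖ ^ 2 < δ :=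
    hJ.eventually (Iio_mem_nhds hδ0)
  have h3 : ∀ᶠ t in 𝓝[<] T, t ∈ Ioo 0 T := Ioo_mem_nhdsLT hT
  obtain ⟨T₁, hT₁T, hT₁⟩ := mem_nhdsLT_iff_exists_Ioo_subset.1 (hC.and (h2.and h3))
  have hT₁T' : T₁ < T := hT₁T
  -- the radius: below `√((T − T₁)/θ)` AND below `R`
  refine ⟨min (Real.sqrt ((T - T₁) / θ)) R,
    lt_min (Real.sqrt_pos.2 (div_pos (sub_pos.2 hT₁T') hθ0)) hR, ?_⟩
  intro r hr hrmin t ht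
  have hrr₀ : r < Real.sqrt ((T - T₁) / θ) := lt_of_lt_of_le hrmin (min_le_left _ _)
  have hrR : r ≤ R := (lt_of_lt_of_le hrmin (min_le_right _ _)).le
  have hballs : ball x₀ r ⊆ ball x₀ R := ball_subset_ball hrR
  have hθr : θ * r ^ 2 < T - T₁ := by
    have h := pow_lt_pow_left₀ hrr₀ hr.le two_ne_zero
    rw [Real.sq_sqrt (div_pos (sub_pos.2 hT₁T') hθ0).le, lt_div_iff₀ hθ0] at h
    linarith
  -- the earlier time `s = T - θ r²`
  set s : ℝ := T - θ * r ^ 2 with hs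
  have hr2 : 0 < θ * r ^ 2 := by positivity
  have hsI : s ∈ Ioo T₁ T := ⟨by rw [hs]; linarith, by rw [hs]; linarith⟩
  obtain ⟨hCs, hDs, hs0T⟩ := hT₁ hsI
  have hTs : T - s = θ * r ^ 2 := by rw [hs]; ring
  have hsqTs : Real.sqrt (T - s) = Real.sqrt θ * r := by
    rw [hTs, Real.sqrt_mul hθ0.le, Real.sqrt_sq hr.le]
  have hsq0 : 0 < Real.sqrt (T - s) := by rw [hsqTs]; positivity
  have hmT : MemLp (u T) 2 volume := hLH.memLp T ⟨hT.le, le_rfl⟩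
  have hms : MemLp (u s) 2 volume := hLH.memLp s ⟨hs0T.1.le, hs0T.2.le⟩
  -- (a) the Type-I cell bound at time `s`
  have hA : ∫⁻ x in ball x₀ r, ‖u s x‖ₑ ^ 2 ≤ ENNReal.ofReal (C ^ 2 / (θ * r ^ 2) * r ^ 3 * V) := by
    refine setLIntegral_ball_le_of_bound hr (by positivity) hV fun x => ?_
    have hx := hCs x
    calc ‖u s x‖ ^ 2 ≤ (C / Real.sqrt (T - s)) ^ 2 := pow_le_pow_left₀ (norm_nonneg _) hx 2
      _ = C ^ 2 / (θ * r ^ 2) := by rw [div_pow, Real.sq_sqrt (by rw [hTs]; positivity), hTs]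
  -- (b) the LOCAL jolt bound at time `s`: `∫_{B_R(x₀)} ‖u(T) − u(s)‖² ≤ δ √θ r`
  have hI_s : ∫ x in ball x₀ R, ‖u T x - u s x‖ ^ 2 ≤ δ * (Real.sqrt θ * r) := by
    have h := mul_lt_mul_of_pos_left hDs hsq0
    rw [← mul_assoc, mul_inv_cancel₀ hsq0.ne', one_mul, hsqTs] at h
    have h' : (∫ x in ball x₀ R, ‖u T x - u s x‖ ^ 2) = ∫ x in ball x₀ R, ‖u s x - u T x‖ ^ 2 := by
      simp_rw [norm_sub_rev (u T _) (u s _)]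
    rw [h', mul_comm (Real.sqrt θ * r) δ] at *
    exact h.le
  have hL_s : ∫⁻ x in ball x₀ R, ‖u T x - u s x‖ₑ ^ 2 ≤ ENNReal.ofReal (δ * (Real.sqrt θ * r)) := by
    rw [lintegral_enorm_sq_eq_ofReal_integral (f := fun x => u T x - u s x)
      ((hmT.sub hms).restrict (ball x₀ R))]
    exact ENNReal.ofReal_le_ofReal hI_s
  -- (c) the cell energy at the terminal time
  have hB : ∫⁻ x in ball x₀ r, ‖u T x‖ₑ ^ 2 ≤ ENNReal.ofReal ((2 * δ * Real.sqrt θ + 2 * W) * r) := by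
    calc ∫⁻ x in ball x₀ r, ‖u T x‖ₑ ^ 2
        ≤ 2 * (∫⁻ x in ball x₀ r, ‖u T x - u s x‖ₑ ^ 2) + 2 * ∫⁻ x in ball x₀ r, ‖u s x‖ₑ ^ 2 :=
          setLIntegral_enorm_sq_le hms.1 _
      _ ≤ 2 * ENNReal.ofReal (δ * (Real.sqrt θ * r)) + 2 * ENNReal.ofReal (C ^ 2 / (θ * r ^ 2) * r ^ 3 * V) :=
          add_le_add (mul_le_mul_right ((lintegral_mono_set hballs).trans hL_s) 2)
            (mul_le_mul_right hA 2)
      _ = ENNReal.ofReal (2 * (δ * (Real.sqrt θ * r)) + 2 * (C ^ 2 / (θ * r ^ 2) * r ^ 3 * V)) :=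
          two_mul_ofReal_add (by positivity) (by positivity)
      _ = ENNReal.ofReal ((2 * δ * Real.sqrt θ + 2 * W) * r) := by
          congr 1
          rw [hWdef]
          field_simp
  have hAε : 2 * δ * Real.sqrt θ + 2 * W ≤ ε / 4 := by linarith
  -- (d) the two cases `t = T` and `t < T`
  rcases ht.2.eq_or_lt with rfl | htT
  · calc ∫⁻ x in ball x₀ r, ‖u t x‖ₑ ^ 2 ≤ ENNReal.ofReal ((2 * δ * Real.sqrt θ + 2 * W) * r) := hB
      _ ≤ ENNReal.ofReal (ε * r) :=
          ENNReal.ofReal_le_ofReal (mul_le_mul_of_nonneg_right (by linarith) hr.le)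
  · have ht₁ : T₁ < t := by
      have : T - θ * r ^ 2 ≤ T - r ^ 2 := by nlinarith [sq_nonneg r]
      linarith [ht.1, hsI.1]
    obtain ⟨-, hDt, ht0T⟩ := hT₁ ⟨ht₁, htT⟩
    have hmt : MemLp (u t) 2 volume := hLH.memLp t ⟨ht0T.1.le, ht0T.2.le⟩
    have hTt : 0 < T - t := sub_pos.2 htT
    have hsqt : Real.sqrt (T - t) < r := by
      calc Real.sqrt (T - t) < Real.sqrt (r ^ 2) := Real.sqrt_lt_sqrt hTt.le (by linarith [ht.1])
        _ = r := Real.sqrt_sq hr.le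
    have hsqt0 : 0 < Real.sqrt (T - t) := Real.sqrt_pos.2 hTt
    have hI_t : ∫ x in ball x₀ R, ‖u t x - u T x‖ ^ 2 ≤ δ * r := by
      have h := mul_lt_mul_of_pos_left hDt hsqt0
      rw [← mul_assoc, mul_inv_cancel₀ hsqt0.ne', one_mul] at h
      have h' : Real.sqrt (T - t) * δ ≤ r * δ := mul_le_mul_of_nonneg_right hsqt.le hδ0.le
      linarith
    have hL_t : ∫⁻ x in ball x₀ R, ‖u t x - u T x‖ₑ ^ 2 ≤ ENNReal.ofReal (δ * r) := by
      rw [lintegral_enorm_sq_eq_ofReal_integral (f := fun x => u t x - u T x)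
        ((hmt.sub hmT).restrict (ball x₀ R))]
      exact ENNReal.ofReal_le_ofReal hI_t
    have hsum : 2 * δ + 2 * (2 * δ * Real.sqrt θ + 2 * W) ≤ ε := by linarith
    calc ∫⁻ x in ball x₀ r, ‖u t x‖ₑ ^ 2
        ≤ 2 * (∫⁻ x in ball x₀ r, ‖u t x - u T x‖ₑ ^ 2) + 2 * ∫⁻ x in ball x₀ r, ‖u T x‖ₑ ^ 2 :=
          setLIntegral_enorm_sq_le hmT.1 _
      _ ≤ 2 * ENNReal.ofReal (δ * r) + 2 * ENNReal.ofReal ((2 * δ * Real.sqrt θ + 2 * W) * r) :=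
          add_le_add (mul_le_mul_right ((lintegral_mono_set hballs).trans hL_t) 2)
            (mul_le_mul_right hB 2)
      _ = ENNReal.ofReal (2 * (δ * r) + 2 * ((2 * δ * Real.sqrt θ + 2 * W) * r)) :=
          two_mul_ofReal_add (by positivity) (by positivity)
      _ ≤ ENNReal.ofReal (ε * r) := by
          refine ENNReal.ofReal_le_ofReal ?_
          calc 2 * (δ * r) + 2 * ((2 * δ * Real.sqrt θ + 2 * W) * r)
              = (2 * δ + 2 * (2 * δ * Real.sqrt θ + 2 * W)) * r := by ring
            _ ≤ ε * r := mul_le_mul_of_nonneg_right hsum hr.le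

end JoltFlatCell

namespace NoTerminalJolt

/-! ### The local Type-I jolt law -/

/-- **A point without local jolt is not a singular vertex (Type-I frame).** In the frame of the route
with viscosity `ν` (classical on `[0,T)`, Leray–Hopf on `[0,T]`), the Type-I rate at `T` and NO LOCAL
TERMINAL JOLT AT `x₀` — `(√(T−t))⁻¹ ∫_{B_R(x₀)} ‖u(t) − u(T)‖² → 0` as `t ↑ T` for some `R > 0` — are
incompatible with `(T, x₀)` being a singular vertex (`u` essentially unbounded on every parabolic
cylinder `Q_r(T, x₀)`, `r² < T`): `JoltFlatCell.main_of_isTypeIBlowup_local` makes the scaled cell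
energy at `x₀` vanish, `NoFlatCellVertex.main_of_isTypeIBlowup` (ε-regularity) refutes the vertex.
[folklore] -/
theorem not_singularVertex_of_isTypeIBlowup_of_tendsto_localJoltFunctional {ν T : ℝ} (hν : 0 < ν)
    (hT : 0 < T) {u : ℝ → EuclideanSpace ℝ (Fin 3) → EuclideanSpace ℝ (Fin 3)}
    {p : ℝ → EuclideanSpace ℝ (Fin 3) → ℝ}
    (hcl : IsClassicalNSSolutionOn (Ico 0 T) ν 0 u p) (hLH : IsLerayHopfOn T ν 0 (u 0) u)
    (hTI : IsTypeIBlowup u T) (x₀ : EuclideanSpace ℝ (Fin 3)) {R : ℝ} (hR : 0 < R)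
    (hJ : Tendsto (fun t : ℝ => (Real.sqrt (T - t))⁻¹ * ∫ x in ball x₀ R, ‖u t x - u T x‖ ^ 2)
      (𝓝[<] T) (𝓝 0)) :
    ¬ (∀ r : ℝ, 0 < r → r ^ 2 < T →
      eLpNorm (uncurry u) ⊤ (volume.restrict (parabolicCylinder r ((T : ℝ), x₀))) = ⊤) :=
  fun hsing => NoFlatCellVertex.main_of_isTypeIBlowup hν hT hcl hLH hTI x₀
    (fun _ hε => JoltFlatCell.main_of_isTypeIBlowup_local hT hLH hTI x₀ hR hJ hε) hsing

/-- **THE LOCAL TYPE-I JOLT LAW.** In the frame with viscosity `ν` (classical on `[0,T)`, Leray–Hopf on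
`[0,T]`) with the Type-I rate at `T`, at a SINGULAR VERTEX `(T, x₀)` the local jolt functional
`(√(T−t))⁻¹ ∫_{B_R(x₀)} ‖u(t) − u(T)‖²` does NOT tend to `0` as `t ↑ T`, for EVERY radius `R > 0`: the
self-similar-rate `L²` approach to the terminal value is witnessed on every ball about every Type-I
singular point. Refines `typeI_terminalJoltLaw` (global functional). [folklore] -/
theorem typeI_localJoltLaw {ν T : ℝ} (hν : 0 < ν) (hT : 0 < T)
    {u : ℝ → EuclideanSpace ℝ (Fin 3) → EuclideanSpace ℝ (Fin 3)}
    {p : ℝ → EuclideanSpace ℝ (Fin 3) → ℝ}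
    (hcl : IsClassicalNSSolutionOn (Ico 0 T) ν 0 u p) (hLH : IsLerayHopfOn T ν 0 (u 0) u)
    (hTI : IsTypeIBlowup u T) {x₀ : EuclideanSpace ℝ (Fin 3)}
    (hsing : ∀ r : ℝ, 0 < r → r ^ 2 < T →
      eLpNorm (uncurry u) ⊤ (volume.restrict (parabolicCylinder r ((T : ℝ), x₀))) = ⊤)
    {R : ℝ} (hR : 0 < R) :
    ¬ Tendsto (fun t : ℝ => (Real.sqrt (T - t))⁻¹ * ∫ x in ball x₀ R, ‖u t x - u T x‖ ^ 2)
      (𝓝[<] T) (𝓝 0) :=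
  fun hJ => not_singularVertex_of_isTypeIBlowup_of_tendsto_localJoltFunctional hν hT hcl hLH hTI x₀
    hR hJ hsing

/-- **The local Type-I jolt law, `limsup` form**: under the hypotheses of `typeI_localJoltLaw`, for
every `R > 0` there is `ε > 0` with `(√(T−t))⁻¹ ∫_{B_R(x₀)} ‖u(t) − u(T)‖² ≥ ε` for `t < T` arbitrarily
close to `T` (`limsup_{t ↑ T} (T−t)^{−1/2} ‖u(t) − u(T)‖²_{L²(B_R(x₀))} > 0`). [folklore] -/
theorem typeI_exists_frequently_le_localJoltFunctional {ν T : ℝ} (hν : 0 < ν) (hT : 0 < T)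
    {u : ℝ → EuclideanSpace ℝ (Fin 3) → EuclideanSpace ℝ (Fin 3)}
    {p : ℝ → EuclideanSpace ℝ (Fin 3) → ℝ}
    (hcl : IsClassicalNSSolutionOn (Ico 0 T) ν 0 u p) (hLH : IsLerayHopfOn T ν 0 (u 0) u)
    (hTI : IsTypeIBlowup u T) {x₀ : EuclideanSpace ℝ (Fin 3)}
    (hsing : ∀ r : ℝ, 0 < r → r ^ 2 < T →
      eLpNorm (uncurry u) ⊤ (volume.restrict (parabolicCylinder r ((T : ℝ), x₀))) = ⊤)
    {R : ℝ} (hR : 0 < R) :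
    ∃ ε : ℝ, 0 < ε ∧ ∃ᶠ t in 𝓝[<] T,
      ε ≤ (Real.sqrt (T - t))⁻¹ * ∫ x in ball x₀ R, ‖u t x - u T x‖ ^ 2 := by
  by_contra h
  push Not at h
  refine typeI_localJoltLaw hν hT hcl hLH hTI hsing hR
    (tendsto_order.2 ⟨fun a ha => ?_, fun b hb => ?_⟩)
  · exact Eventually.of_forall fun t => ha.trans_le
      (mul_nonneg (inv_nonneg.2 (Real.sqrt_nonneg _)) (integral_nonneg fun _ => sq_nonneg _))
  · exact h b hb

/-- **A Type-I first blow-up has a local jolt point.** A MAXIMAL classical solution on `[0,T)` (first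
blow-up at `T`), Leray–Hopf on `[0,T]` from a rapidly decaying datum, with the Type-I rate at `T`,
has a point `x₀` at which the local jolt functional on EVERY ball `B_R(x₀)` fails to tend to `0`:
the singular vertex provided by `exists_singularPoint_of_classical_of_not_hasSmoothExtensionPast`
(ε-regularity contrapositive). [folklore] -/
theorem typeI_exists_localJoltPoint {ν T : ℝ} (hν : 0 < ν) (hT : 0 < T)
    {u : ℝ → EuclideanSpace ℝ (Fin 3) → EuclideanSpace ℝ (Fin 3)}
    {p : ℝ → EuclideanSpace ℝ (Fin 3) → ℝ}
    (hmax : IsMaximalSmoothSolution ν 0 u p T) (hLH : IsLerayHopfOn T ν 0 (u 0) u)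
    (hdec : HasRapidSpatialDecay (u 0)) (hTI : IsTypeIBlowup u T) :
    ∃ x₀ : EuclideanSpace ℝ (Fin 3), ∀ R : ℝ, 0 < R →
      ¬ Tendsto (fun t : ℝ => (Real.sqrt (T - t))⁻¹ * ∫ x in ball x₀ R, ‖u t x - u T x‖ ^ 2)
        (𝓝[<] T) (𝓝 0) := by
  obtain ⟨x₀, hx₀⟩ :=
    exists_singularPoint_of_classical_of_not_hasSmoothExtensionPast hν hT hmax.1 hLH hdec hmax.2
  exact ⟨x₀, fun R hR => typeI_localJoltLaw hν hT hmax.1 hLH hTI hx₀ hR⟩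

/-- **Continuation criterion, local Type-I form.** In the frame (classical on `[0,T)`, Leray–Hopf on
`[0,T]`, rapidly decaying datum), the Type-I rate at `T` and «every point has a jolt-free ball»
(`∀ x₀ ∃ R > 0`, `(√(T−t))⁻¹ ∫_{B_R(x₀)} ‖u(t) − u(T)‖² → 0`) force a smooth extension past `T`.
Refines `hasSmoothExtensionPast_of_isTypeIBlowup_of_tendsto_joltFunctional` (global functional).
[folklore] -/
theorem hasSmoothExtensionPast_of_isTypeIBlowup_of_localNoJolt {ν T : ℝ} (hν : 0 < ν)
    (hT : 0 < T) {u : ℝ → EuclideanSpace ℝ (Fin 3) → EuclideanSpace ℝ (Fin 3)}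
    {p : ℝ → EuclideanSpace ℝ (Fin 3) → ℝ}
    (hcl : IsClassicalNSSolutionOn (Ico 0 T) ν 0 u p) (hLH : IsLerayHopfOn T ν 0 (u 0) u)
    (hdec : HasRapidSpatialDecay (u 0)) (hTI : IsTypeIBlowup u T)
    (hJ : ∀ x₀ : EuclideanSpace ℝ (Fin 3), ∃ R : ℝ, 0 < R ∧
      Tendsto (fun t : ℝ => (Real.sqrt (T - t))⁻¹ * ∫ x in ball x₀ R, ‖u t x - u T x‖ ^ 2)
        (𝓝[<] T) (𝓝 0)) :
    HasSmoothExtensionPast ν 0 u T := by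
  by_contra hext
  obtain ⟨x₀, hx₀⟩ := typeI_exists_localJoltPoint hν hT ⟨hcl, hext⟩ hLH hdec hTI
  obtain ⟨R, hR, hJR⟩ := hJ x₀
  exact hx₀ R hR hJR

/-! ### Global ⇒ local -/

/-- **No terminal jolt ⇒ no local terminal jolt, at every point and radius.** For a Leray–Hopf
solution on `[0,T]` (`T > 0`), if the global jolt functional `(√(T−t))⁻¹ ∫ ‖u(t) − u(T)‖²` tends to `0`
as `t ↑ T`, so does the local one on any ball `B_R(x₀)` (squeeze: `0 ≤ ∫_{B_R(x₀)} ≤ ∫_{ℝ³}` for the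
integrable slice `‖u(t) − u(T)‖²`, `t ∈ [0,T]`). [folklore] -/
theorem tendsto_localJoltFunctional_of_tendsto_joltFunctional {ν T : ℝ} (hT : 0 < T)
    {u : ℝ → EuclideanSpace ℝ (Fin 3) → EuclideanSpace ℝ (Fin 3)}
    (hLH : IsLerayHopfOn T ν 0 (u 0) u)
    (hJ : Tendsto (fun t : ℝ => (Real.sqrt (T - t))⁻¹ * ∫ x, ‖u t x - u T x‖ ^ 2)
      (𝓝[<] T) (𝓝 0))
    (x₀ : EuclideanSpace ℝ (Fin 3)) (R : ℝ) :
    Tendsto (fun t : ℝ => (Real.sqrt (T - t))⁻¹ * ∫ x in ball x₀ R, ‖u t x - u T x‖ ^ 2)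
      (𝓝[<] T) (𝓝 0) := by
  have hmT : MemLp (u T) 2 volume := hLH.memLp T ⟨hT.le, le_rfl⟩
  refine tendsto_of_tendsto_of_tendsto_of_le_of_le' tendsto_const_nhds hJ
    (Eventually.of_forall fun t =>
      mul_nonneg (inv_nonneg.2 (Real.sqrt_nonneg _)) (integral_nonneg fun _ => sq_nonneg _)) ?_
  filter_upwards [Ioo_mem_nhdsLT hT] with t ht
  have hmt : MemLp (u t) 2 volume := hLH.memLp t ⟨ht.1.le, ht.2.le⟩
  have hint : Integrable (fun x => ‖u t x - u T x‖ ^ 2) volume :=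
    (memLp_two_iff_integrable_sq_norm (hmt.sub hmT).1).1 (hmt.sub hmT)
  exact mul_le_mul_of_nonneg_left
    (setIntegral_le_integral hint (Eventually.of_forall fun x => sq_nonneg _))
    (inv_nonneg.2 (Real.sqrt_nonneg _))

end NoTerminalJolt


end Summit.NavierStokesRegularity.NavierStokesRegularity.Theorems

end
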